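import Literature.Probability.Process.StableLikeJumpChainTight
import Literature.Probability.Process.StableLikeJumpChainDiag
import HarnessLib

/-!
# Tightness of stable-like chains: `E_x (1+‖X_n − x‖)^{α/4} ≤ U n^{1/4}` and tail bounds

Support file for the proof of Bass–Levin 2002, Theorem 1.1
(`Literature.Probability.Process.bassLevin_thm_1_1`). We assemble the discrete Nash argument:
the moment step (`moment_step`), the entropy bounds (`entropy_lower`, `entropy_upper`), the
dissipation chain (`entropy_dissipation`, `sqrt_energy_le_dissipation`), the carré du champ
and anti-concentration bounds (`gamma_bound`, `inverse_moment_bound`) and the real-variable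
closing lemmas (`le_sqrt_mul_of_forall_pos`, `moment_recursion_bound`) into

* `moment_bound` : `∑_z Q n x z (1+‖z−x‖)^{α/4} ≤ U n^{1/4}` for all `n ≥ 1`, `x`;
* `tail_bound` : `∑_{‖z−x‖ > r} Q n x z ≤ U n^{1/4} (1+r)^{-α/4}`.

This is our replacement for the exit-time estimate Bass–Levin Thm 2.8 (the maximal inequality
converting it into an exit-time bound is `exit_mass_le_of_inner`). [folklore]

## References
* J. Nash, *Continuity of solutions of parabolic and elliptic equations*, Amer. J. Math. 80
  (1958) 931–954, Part II (moment bound).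
* R. F. Bass, D. A. Levin, *Transition probabilities for symmetric jump processes*,
  Trans. Amer. Math. Soc. 354 (2002) 2933–2953, Thm 2.8.
-/

noncomputable section

namespace Literature.Probability.Process

open scoped BigOperators

variable {d : ℕ} {P : (Fin d → ℤ) → (Fin d → ℤ) → ℝ} {Q : ℕ → (Fin d → ℤ) → (Fin d → ℤ) → ℝ}
  {μ : (Fin d → ℤ) → ℝ} {m M c₁ c₂ α : ℝ}

/-- **Nash's moment bound for stable-like chains** (discrete time): there is `U` such that
`∑_z Q n x z (1+‖z−x‖)^{α/4} ≤ U n^{1/4}` for all `n ≥ 1` and all `x`. [folklore] -/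
theorem moment_bound (hd : 1 ≤ d) (hα : 0 < α) (hα2 : α < 2) (hP0 : ∀ x y, 0 ≤ P x y)
    (hP1 : ∀ x, HasSum (P x) 1)
    (hμ : ∀ x, m ≤ μ x ∧ μ x ≤ M) (hm : 0 < m)
    (hrev : ∀ x y, μ x * P x y = μ y * P y x)
    (hlb : ∀ x y, c₁ * ‖x - y‖ ^ (-((d : ℝ) + α)) ≤ P x y) (hc₁ : 0 < c₁)
    (hub : ∀ x y, P x y ≤ c₂ * ‖x - y‖ ^ (-((d : ℝ) + α))) (hc₂ : 0 ≤ c₂)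
    (hQ0 : ∀ x y, Q 0 x y = if x = y then 1 else 0)
    (hQ : ∀ n x y, Q (n + 1) x y = ∑' z, Q n x z * P z y)
    {C_D : ℝ} (hCD : 0 < C_D)
    (hdiag : ∀ (n : ℕ) (x y : Fin d → ℤ), 1 ≤ n → Q n x y ≤ C_D * (n : ℝ) ^ (-(d : ℝ) / α)) :
    ∃ U : ℝ, 0 < U ∧ ∀ (n : ℕ) (x : Fin d → ℤ), 1 ≤ n →
      ∑' z, Q n x z * (1 + ‖z - x‖) ^ (α / 4) ≤ U * (n : ℝ) ^ ((1 : ℝ) / 4) := by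
  have hPs : ∀ x, Summable (P x) := fun x => (hP1 x).summable
  have hP1' : ∀ x, ∑' y, P x y ≤ 1 := fun x => ((hP1 x).tsum_eq).le
  have hμnn : ∀ x, 0 ≤ μ x := fun x => hm.le.trans (hμ x).1
  have hμpos : ∀ x, 0 < μ x := fun x => lt_of_lt_of_le hm (hμ x).1
  have hQnn : ∀ k x w, 0 ≤ Q k x w := kpow_nonneg hP0 hQ0 hQ
  -- β = α/4
  have hβ : 0 < α / 4 := by positivity
  have hβ1 : α / 4 ≤ 1 := by linarith
  have hβα : α / 4 < α := by linarith
  have h2β : 2 * (α / 4) < α := by linarith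
  -- laziness of the two-step kernel
  have hlazy : ∀ y, c₁ ^ 2 ≤ Q 2 y y := fun y => kpow_two_diag_lower hd hP0 hP1 hlb hc₁.le hQ0 hQ y
  have hε₀ : 0 < c₁ ^ 2 := by positivity
  -- constants from the imported estimates
  obtain ⟨CΓ, hCΓ, hΓ⟩ := gamma_bound hd hα hα2 hP0 hP1 hμ hm hrev hub hc₂ hQ0 hQ hβ hβ1 h2β
  have hγ : 0 < α / 2 := by positivity
  have hγd : α / 2 < d := by
    have : (1 : ℝ) ≤ d := by exact_mod_cast hd
    linarith
  obtain ⟨CA, hCA, hA⟩ := inverse_moment_bound hd hα hP0 hP1 hQ0 hQ hCD.le hdiag hγ hγd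
  obtain ⟨A₂, hA₂⟩ := entropy_upper hd hP0 hP1 hμ hm hub hc₂ hQ0 hQ hβ hβ1 hβα
  set C₁ : ℝ := c₂ * (3 ^ d + 2 * d * 3 ^ (d - 1) / (α - α / 4)) with hC₁
  have hC₁nn : 0 ≤ C₁ := by
    rw [hC₁]
    have : 0 < α - α / 4 := by linarith
    positivity
  set CE : ℝ := CΓ * CA with hCE
  set Clz : ℝ := 2 / c₁ ^ 2 + 2 with hClz
  have hClzpos : 0 < Clz := by rw [hClz]; positivity
  set K : ℝ := Real.sqrt (CE * (2 : ℝ) ^ (-(1 : ℝ) / 2) * Clz) with hK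
  have hKnn : 0 ≤ K := Real.sqrt_nonneg _
  set L : ℝ := (d : ℝ) / (α / 4) with hL
  have hLnn : 0 ≤ L := by rw [hL]; positivity
  set A' : ℝ := A₂ + Real.log (C_D / m) with hA'
  -- uniform constant from the real-variable lemma, then the hypotheses for each x
  obtain ⟨U, hU, hUall⟩ := moment_recursion_bound_uniform (A := A') hC₁nn hKnn hLnn
  have key : ∀ x : Fin d → ℤ, ∃ Mf : ℕ → ℝ, (∀ k, Mf k = ∑' z, Q k x z * (1 + ‖z - x‖) ^ (α / 4)) ∧
      Mf 0 = 1 ∧ (∀ k, 1 ≤ Mf k) ∧ (∀ k, Mf (k + 1) ≤ Mf k + C₁) ∧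
      (∀ mm : ℕ, 1 ≤ mm → Mf (4 * mm) ≤ Mf (2 * mm) + K * (mm : ℝ) ^ ((1 : ℝ) / 4) *
        Real.sqrt (max 0 (A' + L * Real.log (Mf (4 * mm) / ((2 * mm : ℕ) : ℝ) ^ ((1 : ℝ) / 4))))) := by
    intro x
    obtain ⟨Mf, hMf⟩ : ∃ Mf : ℕ → ℝ, ∀ k, Mf k = ∑' z, Q k x z * (1 + ‖z - x‖) ^ (α / 4) :=
      ⟨_, fun _ => rfl⟩
    refine ⟨Mf, hMf, ?_, ?_, ?_, ?_⟩
    · -- Mf 0 = 1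
      rw [hMf]
      have : (fun z => Q 0 x z * (1 + ‖z - x‖) ^ (α / 4)) = fun z => if z = x then (1 : ℝ) else 0 := by
        funext z; rw [hQ0]
        by_cases h : z = x
        · rw [h]; simp
        · simp [h, Ne.symm h]
      rw [this, tsum_ite_eq]
    · intro k; rw [hMf]; exact (hA₂ k x).1
    · intro k; rw [hMf, hMf]
      exact (kpow_moment_summable hd hP0 hP1 hub hc₂ hQ0 hQ hβ hβ1 hβα x k).2
    · intro mm hmm
      -- entropy functional
      obtain ⟨Hf, hHf⟩ : ∃ Hf : ℕ → ℝ, ∀ k, Hf k = -∑' z, μ z * (Q k x z / μ z * Real.log (Q k x z / μ z)) :=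
        ⟨_, fun _ => rfl⟩
      -- Hf is nondecreasing along even steps with the dissipation
      have hdiss : ∀ i, (1 / (4 : ℝ)) * 0 ≤ 0 ∧
          ∑' y, μ y * ∑' z, Q 2 y z * (Real.sqrt (Q i x y / μ y) - Real.sqrt (Q i x z / μ z)) ^ 2 ≤
            Clz * (Hf (i + 2) - Hf i) := by
        intro i
        refine ⟨by norm_num, ?_⟩
        obtain ⟨-, -, h1⟩ := sqrt_energy_le_dissipation hd hP0 hP1 hμ hm hrev hub hc₂ hα hQ0 hQ hε₀ hlazy i x
        obtain ⟨-, -, h2⟩ := entropy_dissipation hd hP0 hP1 hμ hm hrev hub hc₂ hα hQ0 hQ i x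
        calc _ ≤ (2 / c₁ ^ 2 + 2) * _ := h1
          _ ≤ Clz * (Hf (i + 2) - Hf i) := by
              rw [hClz, hHf, hHf]; exact mul_le_mul_of_nonneg_left h2 (by positivity)
      have hHmono : ∀ i, Hf i ≤ Hf (i + 2) := by
        intro i
        have h := (hdiss i).2
        have h0 : 0 ≤ ∑' y, μ y * ∑' z, Q 2 y z * (Real.sqrt (Q i x y / μ y) - Real.sqrt (Q i x z / μ z)) ^ 2 :=
          tsum_nonneg fun y => mul_nonneg (hμnn y) (tsum_nonneg fun z => mul_nonneg (hQnn 2 y z) (sq_nonneg _))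
        have : 0 ≤ Clz * (Hf (i + 2) - Hf i) := h0.trans h
        have := (mul_nonneg_iff_of_pos_left hClzpos).mp this
        linarith
      -- E_Γ(i) ≤ CE i^{-1/2} for i ≥ 1
      have hEΓ : ∀ i : ℕ, 1 ≤ i →
          ∑' y, Q i x y * ∑' z, Q 2 y z * ((1 + ‖y - x‖) ^ (α / 4) - (1 + ‖z - x‖) ^ (α / 4)) ^ 2 ≤
            CE * (i : ℝ) ^ (-(1 : ℝ) / 2) := by
        intro i hi
        obtain ⟨hAs, hAle⟩ := hA i x hi
        have hpt : ∀ y, Q i x y * ∑' z, Q 2 y z * ((1 + ‖y - x‖) ^ (α / 4) - (1 + ‖z - x‖) ^ (α / 4)) ^ 2 ≤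
            CΓ * (Q i x y * (1 + ‖y - x‖) ^ (-(α / 2))) := by
          intro y
          have h := (hΓ x y).2
          have hexp : 2 * (α / 4) - α = -(α / 2) := by ring
          rw [hexp] at h
          calc _ ≤ Q i x y * (CΓ * (1 + ‖y - x‖) ^ (-(α / 2))) := mul_le_mul_of_nonneg_left h (hQnn i x y)
            _ = _ := by ring
        obtain ⟨-, hEs, -, -, -⟩ := tsum_swap_gamma hd hα hα2 hP0 hP1 hμ hm hrev hub hc₂ hQ0 hQ hβ hβ1 h2β i x
        calc _ ≤ ∑' y, CΓ * (Q i x y * (1 + ‖y - x‖) ^ (-(α / 2))) := Summable.tsum_le_tsum hpt hEs (hAs.mul_left CΓ)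
          _ = CΓ * ∑' y, Q i x y * (1 + ‖y - x‖) ^ (-(α / 2)) := tsum_mul_left
          _ ≤ CΓ * (CA * (i : ℝ) ^ (-(α / 2) / α)) := mul_le_mul_of_nonneg_left hAle hCΓ.le
          _ = CE * (i : ℝ) ^ (-(1 : ℝ) / 2) := by
              rw [hCE, mul_assoc]; congr 2; field_simp
      -- the moment step along even times 2mm + 2j
      have hstep2 : ∀ (j : ℕ) (t : ℝ), 0 < t →
          Mf (2 * mm + 2 * j + 2) - Mf (2 * mm + 2 * j) ≤
            t * (CE * ((2 * mm : ℕ) : ℝ) ^ (-(1 : ℝ) / 2)) +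
            1 / (4 * t) * (Clz * (Hf (2 * mm + 2 * j + 2) - Hf (2 * mm + 2 * j))) := by
        intro j t ht
        have h := moment_step hd hα hα2 hP0 hP1 hμ hm hrev hub hc₂ hQ0 hQ hβ hβ1 h2β hε₀ hlazy (2 * mm + 2 * j) x ht
        rw [hMf, hMf]
        have hi : 1 ≤ 2 * mm + 2 * j := by omega
        have hE := hEΓ (2 * mm + 2 * j) hi
        have hEmono : CE * (((2 * mm + 2 * j : ℕ) : ℝ)) ^ (-(1 : ℝ) / 2) ≤ CE * ((2 * mm : ℕ) : ℝ) ^ (-(1 : ℝ) / 2) := by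
          refine mul_le_mul_of_nonneg_left ?_ (by rw [hCE]; positivity)
          exact Real.rpow_le_rpow_of_nonpos (by exact_mod_cast (by omega : 0 < 2 * mm))
            (by exact_mod_cast (by omega : 2 * mm ≤ 2 * mm + 2 * j)) (by norm_num)
        have hG := (hdiss (2 * mm + 2 * j)).2
        have ht4 : 0 ≤ 1 / (4 * t) := by positivity
        calc _ ≤ t * ∑' y, Q (2 * mm + 2 * j) x y * ∑' z, Q 2 y z *
              ((1 + ‖y - x‖) ^ (α / 4) - (1 + ‖z - x‖) ^ (α / 4)) ^ 2 +
            1 / (4 * t) * ∑' y, μ y * ∑' z, Q 2 y z *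
              (Real.sqrt (Q (2 * mm + 2 * j) x y / μ y) - Real.sqrt (Q (2 * mm + 2 * j) x z / μ z)) ^ 2 := h
          _ ≤ t * (CE * ((2 * mm : ℕ) : ℝ) ^ (-(1 : ℝ) / 2)) +
              1 / (4 * t) * (Clz * (Hf (2 * mm + 2 * j + 2) - Hf (2 * mm + 2 * j))) :=
            add_le_add (mul_le_mul_of_nonneg_left (hE.trans hEmono) ht.le) (mul_le_mul_of_nonneg_left hG ht4)
      -- sum over j < mm (telescoping)
      have hblock : ∀ t : ℝ, 0 < t → Mf (4 * mm) - Mf (2 * mm) ≤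
          t * ((mm : ℝ) * (CE * ((2 * mm : ℕ) : ℝ) ^ (-(1 : ℝ) / 2))) +
          (Clz * (Hf (4 * mm) - Hf (2 * mm))) / (4 * t) := by
        intro t ht
        have htel : Mf (4 * mm) - Mf (2 * mm) =
            ∑ j ∈ Finset.range mm, (Mf (2 * mm + 2 * j + 2) - Mf (2 * mm + 2 * j)) := by
          have := Finset.sum_range_sub (fun j => Mf (2 * mm + 2 * j)) mm
          rw [show 2 * mm + 2 * mm = 4 * mm by ring, Nat.mul_zero, Nat.add_zero] at this
          rw [← this]
          refine Finset.sum_congr rfl fun j _ => ?_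
          rw [show 2 * mm + 2 * (j + 1) = 2 * mm + 2 * j + 2 by ring]
        have htelH : ∑ j ∈ Finset.range mm, (Hf (2 * mm + 2 * j + 2) - Hf (2 * mm + 2 * j)) = Hf (4 * mm) - Hf (2 * mm) := by
          have := Finset.sum_range_sub (fun j => Hf (2 * mm + 2 * j)) mm
          rw [show 2 * mm + 2 * mm = 4 * mm by ring, Nat.mul_zero, Nat.add_zero] at this
          rw [← this]
          refine Finset.sum_congr rfl fun j _ => ?_
          rw [show 2 * mm + 2 * (j + 1) = 2 * mm + 2 * j + 2 by ring]
        rw [htel]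
        calc ∑ j ∈ Finset.range mm, (Mf (2 * mm + 2 * j + 2) - Mf (2 * mm + 2 * j))
            ≤ ∑ j ∈ Finset.range mm, (t * (CE * ((2 * mm : ℕ) : ℝ) ^ (-(1 : ℝ) / 2)) +
                1 / (4 * t) * (Clz * (Hf (2 * mm + 2 * j + 2) - Hf (2 * mm + 2 * j)))) :=
              Finset.sum_le_sum fun j _ => hstep2 j t ht
          _ = (mm : ℝ) * (t * (CE * ((2 * mm : ℕ) : ℝ) ^ (-(1 : ℝ) / 2))) +
              1 / (4 * t) * (Clz * (Hf (4 * mm) - Hf (2 * mm))) := by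
              rw [Finset.sum_add_distrib, Finset.sum_const, Finset.card_range, nsmul_eq_mul, ← Finset.mul_sum,
                ← Finset.mul_sum, htelH]
          _ = _ := by ring
      -- optimise in t
      have hAnn : 0 ≤ (mm : ℝ) * (CE * ((2 * mm : ℕ) : ℝ) ^ (-(1 : ℝ) / 2)) := by rw [hCE]; positivity
      have hHdiff : 0 ≤ Hf (4 * mm) - Hf (2 * mm) := by
        have : ∀ j, Hf (2 * mm) ≤ Hf (2 * mm + 2 * j) := by
          intro j
          induction j with
          | zero => simp
          | succ j ih => exact ih.trans (by rw [show 2 * mm + 2 * (j + 1) = 2 * mm + 2 * j + 2 by ring]; exact hHmono _)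
        have h := this mm
        rw [show 2 * mm + 2 * mm = 4 * mm by ring] at h
        linarith
      have hBnn : 0 ≤ Clz * (Hf (4 * mm) - Hf (2 * mm)) := mul_nonneg hClzpos.le hHdiff
      have hsq := le_sqrt_mul_of_forall_pos hAnn hBnn hblock
      -- bound the entropy difference
      have hmm0 : (0 : ℝ) < mm := by exact_mod_cast hmm
      have h2mm : (0 : ℝ) < ((2 * mm : ℕ) : ℝ) := by push_cast; linarith
      have hup := (hA₂ (4 * mm) x).2
      have hlow := entropy_lower hd hα hP0 hP1 hμ hm hub hc₂ hQ0 hQ hCD hdiag (by omega : 1 ≤ 2 * mm) x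
      rw [← hHf] at hup hlow
      rw [← hMf] at hup
      have hM4pos : 0 < Mf (4 * mm) := lt_of_lt_of_le one_pos (by rw [hMf]; exact (hA₂ (4 * mm) x).1)
      have hHle : Hf (4 * mm) - Hf (2 * mm) ≤
          A' + L * Real.log (Mf (4 * mm) / ((2 * mm : ℕ) : ℝ) ^ ((1 : ℝ) / 4)) := by
        rw [Real.log_div hM4pos.ne' (Real.rpow_pos_of_pos h2mm _).ne', Real.log_rpow h2mm, hA']
        have : (d : ℝ) / α * Real.log ((2 * mm : ℕ) : ℝ) = L * ((1 : ℝ) / 4 * Real.log ((2 * mm : ℕ) : ℝ)) := by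
          rw [hL]; field_simp
        linarith
      -- assemble: √(A B) ≤ K mm^{1/4} √(max 0 (...))
      have hAB : (mm : ℝ) * (CE * ((2 * mm : ℕ) : ℝ) ^ (-(1 : ℝ) / 2)) * (Clz * (Hf (4 * mm) - Hf (2 * mm))) ≤
          (K * (mm : ℝ) ^ ((1 : ℝ) / 4)) ^ 2 * max 0 (A' + L * Real.log (Mf (4 * mm) / ((2 * mm : ℕ) : ℝ) ^ ((1 : ℝ) / 4))) := by
        have hK2 : (K * (mm : ℝ) ^ ((1 : ℝ) / 4)) ^ 2 = (mm : ℝ) * (CE * ((2 * mm : ℕ) : ℝ) ^ (-(1 : ℝ) / 2)) * Clz := by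
          rw [mul_pow, hK, Real.sq_sqrt (by rw [hCE]; positivity)]
          have h1 : ((mm : ℝ) ^ ((1 : ℝ) / 4)) ^ 2 = (mm : ℝ) ^ ((1 : ℝ) / 2) := by
            rw [← Real.rpow_natCast, ← Real.rpow_mul hmm0.le]; norm_num
          have h2 : ((2 * mm : ℕ) : ℝ) ^ (-(1 : ℝ) / 2) = (2 : ℝ) ^ (-(1 : ℝ) / 2) * (mm : ℝ) ^ (-(1 : ℝ) / 2) := by
            push_cast; exact Real.mul_rpow (by norm_num) hmm0.le
          have h3 : (mm : ℝ) ^ ((1 : ℝ) / 2) = (mm : ℝ) * (mm : ℝ) ^ (-(1 : ℝ) / 2) := by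
            rw [show (mm : ℝ) * (mm : ℝ) ^ (-(1 : ℝ) / 2) = (mm : ℝ) ^ (1 : ℝ) * (mm : ℝ) ^ (-(1 : ℝ) / 2) by
              rw [Real.rpow_one], ← Real.rpow_add hmm0]; norm_num
          rw [h1, h2, h3]; ring
        rw [hK2]
        have hpos : 0 ≤ (mm : ℝ) * (CE * ((2 * mm : ℕ) : ℝ) ^ (-(1 : ℝ) / 2)) * Clz := mul_nonneg hAnn hClzpos.le
        calc (mm : ℝ) * (CE * ((2 * mm : ℕ) : ℝ) ^ (-(1 : ℝ) / 2)) * (Clz * (Hf (4 * mm) - Hf (2 * mm)))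
            = ((mm : ℝ) * (CE * ((2 * mm : ℕ) : ℝ) ^ (-(1 : ℝ) / 2)) * Clz) * (Hf (4 * mm) - Hf (2 * mm)) := by ring
          _ ≤ ((mm : ℝ) * (CE * ((2 * mm : ℕ) : ℝ) ^ (-(1 : ℝ) / 2)) * Clz) *
              max 0 (A' + L * Real.log (Mf (4 * mm) / ((2 * mm : ℕ) : ℝ) ^ ((1 : ℝ) / 4))) :=
            mul_le_mul_of_nonneg_left (hHle.trans (le_max_right _ _)) hpos
      have hfinal : Real.sqrt ((mm : ℝ) * (CE * ((2 * mm : ℕ) : ℝ) ^ (-(1 : ℝ) / 2)) * (Clz * (Hf (4 * mm) - Hf (2 * mm)))) ≤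
          K * (mm : ℝ) ^ ((1 : ℝ) / 4) * Real.sqrt (max 0 (A' + L * Real.log (Mf (4 * mm) / ((2 * mm : ℕ) : ℝ) ^ ((1 : ℝ) / 4)))) := by
        have hKm : 0 ≤ K * (mm : ℝ) ^ ((1 : ℝ) / 4) := by positivity
        calc _ ≤ Real.sqrt ((K * (mm : ℝ) ^ ((1 : ℝ) / 4)) ^ 2 *
              max 0 (A' + L * Real.log (Mf (4 * mm) / ((2 * mm : ℕ) : ℝ) ^ ((1 : ℝ) / 4)))) := Real.sqrt_le_sqrt hAB
          _ = _ := by rw [Real.sqrt_mul (sq_nonneg _), Real.sqrt_sq hKm]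
      linarith
  refine ⟨U, hU, fun n x hn => ?_⟩
  obtain ⟨Mf, hMf, hM0, hM1, hstep, hrec⟩ := key x
  have := hUall Mf hM0 hM1 hstep hrec n hn
  rwa [hMf] at this

/-- **Tail bound (tightness)**: `∑_{‖z−x‖>r} Q n x z ≤ U n^{1/4} (1+r)^{-α/4}` for `n ≥ 1`,
`r ≥ 0`. In particular `P_x(‖X_n − x‖ > r) ≤ U (n/r^α)^{1/4}`. [folklore] -/
theorem tail_bound (hd : 1 ≤ d) (hα : 0 < α) (hα2 : α < 2) (hP0 : ∀ x y, 0 ≤ P x y)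
    (hP1 : ∀ x, HasSum (P x) 1)
    (hμ : ∀ x, m ≤ μ x ∧ μ x ≤ M) (hm : 0 < m)
    (hrev : ∀ x y, μ x * P x y = μ y * P y x)
    (hlb : ∀ x y, c₁ * ‖x - y‖ ^ (-((d : ℝ) + α)) ≤ P x y) (hc₁ : 0 < c₁)
    (hub : ∀ x y, P x y ≤ c₂ * ‖x - y‖ ^ (-((d : ℝ) + α))) (hc₂ : 0 ≤ c₂)
    (hQ0 : ∀ x y, Q 0 x y = if x = y then 1 else 0)
    (hQ : ∀ n x y, Q (n + 1) x y = ∑' z, Q n x z * P z y)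
    {C_D : ℝ} (hCD : 0 < C_D)
    (hdiag : ∀ (n : ℕ) (x y : Fin d → ℤ), 1 ≤ n → Q n x y ≤ C_D * (n : ℝ) ^ (-(d : ℝ) / α)) :
    ∃ U : ℝ, 0 < U ∧ ∀ (n : ℕ) (x : Fin d → ℤ) (r : ℝ), 1 ≤ n → 0 ≤ r →
      ∑' z, {z | r < ‖z - x‖}.indicator (Q n x) z ≤ U * (n : ℝ) ^ ((1 : ℝ) / 4) * (1 + r) ^ (-(α / 4)) := by
  have hPs : ∀ x, Summable (P x) := fun x => (hP1 x).summable
  have hP1' : ∀ x, ∑' y, P x y ≤ 1 := fun x => ((hP1 x).tsum_eq).le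
  have hQnn : ∀ k x w, 0 ≤ Q k x w := kpow_nonneg hP0 hQ0 hQ
  obtain ⟨U, hU, hmom⟩ := moment_bound hd hα hα2 hP0 hP1 hμ hm hrev hlb hc₁ hub hc₂ hQ0 hQ hCD hdiag
  refine ⟨U, hU, fun n x r hn hr => ?_⟩
  have hβ : 0 < α / 4 := by positivity
  have hsum := (kpow_moment_summable hd hP0 hP1 hub hc₂ hQ0 hQ hβ (by linarith) (by linarith) x n).1
  have hrpos : 0 < 1 + r := by linarith
  -- pointwise: indicator ≤ Q (1+‖z-x‖)^{α/4} (1+r)^{-α/4}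
  have hpt : ∀ z, {z | r < ‖z - x‖}.indicator (Q n x) z ≤
      (1 + r) ^ (-(α / 4)) * (Q n x z * (1 + ‖z - x‖) ^ (α / 4)) := by
    intro z
    by_cases hz : z ∈ {z | r < ‖z - x‖}
    · rw [Set.indicator_of_mem hz]
      have hz' : r < ‖z - x‖ := hz
      have h1 : 1 ≤ (1 + r) ^ (-(α / 4)) * (1 + ‖z - x‖) ^ (α / 4) := by
        have : (1 + r) ^ (α / 4) ≤ (1 + ‖z - x‖) ^ (α / 4) :=
          Real.rpow_le_rpow hrpos.le (by linarith) hβ.le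
        rw [Real.rpow_neg hrpos.le, inv_mul_eq_div, one_le_div (Real.rpow_pos_of_pos hrpos _)]
        exact this
      calc Q n x z = Q n x z * 1 := (mul_one _).symm
        _ ≤ Q n x z * ((1 + r) ^ (-(α / 4)) * (1 + ‖z - x‖) ^ (α / 4)) := mul_le_mul_of_nonneg_left h1 (hQnn n x z)
        _ = _ := by ring
    · rw [Set.indicator_of_notMem hz]
      exact mul_nonneg (Real.rpow_nonneg hrpos.le _) (mul_nonneg (hQnn n x z) (Real.rpow_nonneg (by positivity) _))
  calc ∑' z, {z | r < ‖z - x‖}.indicator (Q n x) z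
      ≤ ∑' z, (1 + r) ^ (-(α / 4)) * (Q n x z * (1 + ‖z - x‖) ^ (α / 4)) :=
        Summable.tsum_le_tsum hpt ((kpow_summable hP0 hPs hP1' hQ0 hQ n x).indicator _) (hsum.mul_left _)
    _ = (1 + r) ^ (-(α / 4)) * ∑' z, Q n x z * (1 + ‖z - x‖) ^ (α / 4) := tsum_mul_left
    _ ≤ (1 + r) ^ (-(α / 4)) * (U * (n : ℝ) ^ ((1 : ℝ) / 4)) :=
        mul_le_mul_of_nonneg_left (hmom n x hn) (Real.rpow_nonneg hrpos.le _)
    _ = U * (n : ℝ) ^ ((1 : ℝ) / 4) * (1 + r) ^ (-(α / 4)) := by ring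

end Literature.Probability.Process
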